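import Literature.Computability.Complexity.TVHardnessWord
import Literature.Computability.Complexity.TVCheckerParse
import Literature.Computability.Complexity.TVDsrMachine
import Literature.Barriers.QuantumAdvantage.TQBFCodewords
import Literature.Barriers.QuantumAdvantage.TQBFFlatStepCode
import Literature.Computability.Complexity.ReductionsProofs
import HarnessLib

/-!
# `PSPACE`-hardness of Trevisan–Vadhan's language (TV07 Thm. 4.3 via Lemma 4.1 (ii)), and
# Murray–Williams' `NQP ⊄ ACC⁰` discharged

Literature / complexity — the last file of the `PSPACE`-hardness of `QBFUniv.LTV` (`TVFunction.lean`):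
the Karp reduction `TQBF ≤ₚ LTV` mapping the code `⟨qs, ⟨1^{size}, code matrix⟩⟩` of a closed prenex
QBF `ψ` (`PrenexQBF.encode`, `AaronsonChenOracle.lean`) to the query word of stage `0`, selector `0`,
of the Boolean point describing `ψ` for Trevisan–Vadhan's universal formula of size
`n = QBFUniv.sizeOf ψ` (`TVHardnessWord.lean`: the point bits; here the padding to the canonical length
`h n 0` with the layout bricks of `TVCheckerParse.lean`, and the guard by the code test
`TQBFEval.validFn` of `TQBFCodewords.lean`):

* `TVHard.redFn` with `redFn_mem_FP`, `redFn_encode` (`= wordOf n (ubv (instOf …)) 0 (h n 0)` on the code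
  of a closed formula), `redFn_of_invalid` (`= ε` otherwise);
* `TVHard.FB_wordOf_zero` (`F` on that word is the truth of the described formula),
  **`TVHard.tqbf_reducible_LTV : TQBF ≤ₚ LTV`**, **`TVHard.isHard_PSPACE_LTV`** (TV07 Thm. 4.3: the
  language is `PSPACE`-hard);
* hence **`MurrayWilliams2018_NQP_not_subset_ACC0_holds`** (the tree's named fact
  `MurrayWilliams2018_NQP_not_subset_ACC0 : ¬ (NQP ⊆ ACC0)`, `CircuitLowerBounds.lean`, via
  `MurrayWilliams2018_NQP_not_subset_ACC0_of_isHard_LTV` of `TVDsrMachine.lean`),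
  `MurrayWilliams2018_thm_2_2_language_holds'` (the language of MW Thm. 2.2 exists) and
  `MurrayWilliams2018_lemma_4_1_ae_of_umansGenerator` (Lemma 4.1 a.e. needs only Umans' generator).

Everything is proved; no named fact is introduced (D-0026).

## References

* L. Trevisan, S. Vadhan, Comput. Complexity 16 (2007), §4, Lemma 4.1, Thm. 4.3 [TrevisanVadhan2007].
* C. D. Murray, R. R. Williams, STOC 2018 / SIAM J. Comput. 49(5) (2020), §1.1, Thm. 1.3, Thm. 2.2
  [MurrayWilliams2018].
* R. Santhanam, SIAM J. Comput. 39 (2009), Lemma 12 [Santhanam2009].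
* S. Arora, B. Barak, CUP 2009, Thm. 4.13, Thm. 2.8 [AroraBarakCC2009].
-/

noncomputable section

namespace Literature.Computability.Complexity

namespace TVHard

open _root_.Computability Polynomial Brick Plumb PreTseitin TVChk QBFUniv SelfCorrect
  Literature.Barriers.QuantumAdvantage Literature.Barriers.QuantumAdvantage.TQBFRed Literature.Barriers.QuantumAdvantage.TQBFEval

open scoped Literature.Computability.Complexity.Notation

/-! ### Parsing the code of a prenex QBF -/

/-- `qs`. [folklore] -/
def zQ : List Bool → List Bool := fstF
/-- `1^{size}`. [folklore] -/
def zU : List Bool → List Bool := fstF ∘ sndF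
/-- The matrix code. [folklore] -/
def zC : List Bool → List Bool := sndF ∘ sndF
/-- `1^V`, `V = |qs|`. [folklore] -/
def zV : List Bool → List Bool := polyFn X ∘ zQ
/-- `1^{V + size}`. [folklore] -/
def zVU : List Bool → List Bool := appF ∘ fanoutFn zV zU
/-- `1^{3 size + 1}`. [folklore] -/
def z3U : List Bool → List Bool := List.cons true ∘ appF ∘ fanoutFn zU (appF ∘ fanoutFn zU zU)
/-- **`1ⁿ`, `n = sizeOf = max (V + size) (3 size + 1)`.** [cite: TrevisanVadhan2007, Lemma 4.1 (ii)] -/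
def zN : List Bool → List Bool := iteFn (ltLenF ∘ fanoutFn zVU z3U) z3U zVU
/-- `0^{Mof n}`. [folklore] -/
def zM : List Bool → List Bool := dropFn ∘ fanoutFn (fun _ => ones 1) (zerosOf ∘ blkOf zN)
/-- The context record of the word bricks. [folklore] -/
def zW : List Bool → List Bool := fanoutFn zC (fanoutFn zQ (fanoutFn zV (fanoutFn zU (fanoutFn zN zM))))
/-- **The word**: point bits, selector `0` (`0^{blk n}`), padding `0^{pre n + mlen n}`. [cite: TrevisanVadhan2007, Thm. 4.3 (proof)] -/
def zWord : List Bool → List Bool :=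
  appF ∘ fanoutFn (appF ∘ fanoutFn (ptBitsF ∘ zW) (zerosOf ∘ blkOf zN))
    (appF ∘ fanoutFn (zerosOf ∘ preOf ∘ fanoutFn zN (polyFn (30 * X ^ 5) ∘ zN)) (zerosOf ∘ mlenOf zN))
/-- **The reduction**: the word on the codes of closed prenex formulas, `ε` elsewhere. [cite: TrevisanVadhan2007, Thm. 4.3] -/
def redFn : List Bool → List Bool := iteFn validFn zWord fun _ => []

/-- The parsing bricks are in `FP`. [folklore] -/
theorem z_mem_FP : zQ ∈ FP ∧ zU ∈ FP ∧ zC ∈ FP ∧ zV ∈ FP ∧ zN ∈ FP ∧ zM ∈ FP ∧ zW ∈ FP := by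
  have hQ : zQ ∈ FP := fstF_mem_FP
  have hU : zU ∈ FP := comp_mem_FP fstF_mem_FP sndF_mem_FP
  have hC : zC ∈ FP := comp_mem_FP sndF_mem_FP sndF_mem_FP
  have hV : zV ∈ FP := comp_mem_FP (polyFn_mem_FP _) hQ
  have hVU : zVU ∈ FP := comp_mem_FP appF_mem_FP (fanoutFn_mem_FP hV hU)
  have h3 : z3U ∈ FP := comp_mem_FP (cons_mem_FP true) (comp_mem_FP appF_mem_FP (fanoutFn_mem_FP hU (comp_mem_FP appF_mem_FP (fanoutFn_mem_FP hU hU))))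
  have hN : zN ∈ FP := iteFn_mem_FP (comp_mem_FP ltLenF_mem_FP (fanoutFn_mem_FP hVU h3)) h3 hVU
  have hM : zM ∈ FP := comp_mem_FP dropFn_mem_FP (fanoutFn_mem_FP (const_mem_FP _) (comp_mem_FP zerosOf_mem_FP (layout_mem_FP hN).2.2.1))
  exact ⟨hQ, hU, hC, hV, hN, hM, fanoutFn_mem_FP hC (fanoutFn_mem_FP hQ (fanoutFn_mem_FP hV (fanoutFn_mem_FP hU (fanoutFn_mem_FP hN hM))))⟩

/-- **`redFn ∈ FP`.** [cite: TrevisanVadhan2007, Thm. 4.3] [cite: AroraBarakCC2009, §1.3] -/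
theorem redFn_mem_FP : redFn ∈ FP := by
  obtain ⟨-, -, -, -, hN, -, hW⟩ := z_mem_FP
  obtain ⟨-, -, hblk, -, hml, -⟩ := layout_mem_FP hN
  have hword : zWord ∈ FP :=
    comp_mem_FP appF_mem_FP (fanoutFn_mem_FP (comp_mem_FP appF_mem_FP (fanoutFn_mem_FP (comp_mem_FP ptBitsF_mem_FP hW) (comp_mem_FP zerosOf_mem_FP hblk)))
      (comp_mem_FP appF_mem_FP (fanoutFn_mem_FP (comp_mem_FP zerosOf_mem_FP (comp_mem_FP preOf_mem_FP (fanoutFn_mem_FP hN (comp_mem_FP (polyFn_mem_FP _) hN))))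
        (comp_mem_FP zerosOf_mem_FP hml))))
  exact iteFn_mem_FP validFn_mem_FP hword (const_mem_FP _)

/-! ### Values on the code of a formula -/

/-- Values of the parsing bricks on `ψ.encode`. [folklore] -/
theorem z_apply (ψ : PrenexQBF) :
    zQ ψ.encode = ψ.quants ∧ zU ψ.encode = ones ψ.matrix.size ∧ zC ψ.encode = tcode (toks ψ.matrix) ∧ zV ψ.encode = ones ψ.quants.length ∧
    zN ψ.encode = ones (QBFUniv.sizeOf ψ) ∧ zM ψ.encode = List.replicate (Mof (QBFUniv.sizeOf ψ)) false := by
  have henc : ψ.encode = boolPair ψ.quants (boolPair (ones ψ.matrix.size) (tcode (toks ψ.matrix))) := by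
    rw [PrenexQBF.encode]; simp [encodingPropForm, unaryEncodeNat_eq_replicate, ones, code_eq_tcode]
  have hQ : zQ ψ.encode = ψ.quants := by rw [henc, zQ, fstF_boolPair]
  have hU : zU ψ.encode = ones ψ.matrix.size := by rw [henc, zU, Function.comp_apply, sndF_boolPair, fstF_boolPair]
  have hC : zC ψ.encode = tcode (toks ψ.matrix) := by rw [henc, zC, Function.comp_apply, sndF_boolPair, sndF_boolPair]
  have hV : zV ψ.encode = ones ψ.quants.length := by rw [zV, Function.comp_apply, hQ, polyFn_apply, eval_X]
  have hVU : zVU ψ.encode = ones (ψ.quants.length + ψ.matrix.size) := by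
    rw [zVU, Function.comp_apply, fanoutFn_apply, hV, hU, appF_boolPair, ones, ones, ones, List.replicate_append_replicate]
  have h3 : z3U ψ.encode = ones (3 * ψ.matrix.size + 1) := by
    rw [z3U, Function.comp_apply, Function.comp_apply, fanoutFn_apply, hU, Function.comp_apply, fanoutFn_apply, hU, appF_boolPair, appF_boolPair,
      ones, List.replicate_append_replicate, List.replicate_append_replicate, show ψ.matrix.size + (ψ.matrix.size + ψ.matrix.size) = 3 * ψ.matrix.size by ring]
    rfl
  have hN : zN ψ.encode = ones (QBFUniv.sizeOf ψ) := by
    have hc : (ltLenF ∘ fanoutFn zVU z3U) ψ.encode = [decide (ψ.quants.length + ψ.matrix.size < 3 * ψ.matrix.size + 1)] := by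
      rw [Function.comp_apply, fanoutFn_apply, hVU, h3, ltLenF_boolPair, ones, ones, List.length_replicate, List.length_replicate]
    rw [zN, iteFn_apply hc, QBFUniv.sizeOf]
    by_cases hlt : ψ.quants.length + ψ.matrix.size < 3 * ψ.matrix.size + 1
    · rw [decide_eq_true hlt, if_pos rfl, h3, max_eq_right hlt.le]
    · rw [decide_eq_false hlt, if_neg Bool.false_ne_true, hVU, max_eq_left (not_lt.1 hlt)]
  refine ⟨hQ, hU, hC, hV, hN, ?_⟩
  rw [zM, Function.comp_apply, fanoutFn_apply, Function.comp_apply, (layout_apply (G := zN) hN).2.2.1, zerosOf_apply, dropFn_boolPair]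
  simp only [ones, List.length_replicate, List.drop_replicate]
  rfl

/-- The selector `0` in binary is all zeros. [folklore] -/
theorem natBits_zero' : ∀ D : ℕ, natBits D 0 = List.replicate D false
  | 0 => rfl
  | D + 1 => by rw [natBits, natBits_zero' D, List.replicate_succ]; rfl

/-- **On the code of a formula, the word is the query word of the instance point** at stage `0`,
selector `0`, length `h n 0`. [cite: TrevisanVadhan2007, Thm. 4.3 (proof), Lemma 4.1 (ii)] -/
theorem zWord_encode (ψ : PrenexQBF) :
    zWord ψ.encode = wordOf (QBFUniv.sizeOf ψ) (ubv (instOf (QBFUniv.sizeOf ψ) (preQBF3 ψ).quants (cnfP3 ψ.matrix ψ.quants.length)))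
      ⟨0, blk_pos _⟩ (h (QBFUniv.sizeOf ψ) 0) := by
  obtain ⟨hQ, hU, hC, hV, hN, hM⟩ := z_apply ψ
  set n := QBFUniv.sizeOf ψ with hn
  obtain ⟨-, -, hblk, -, hml, -⟩ := layout_apply (G := zN) hN
  have hW : zW ψ.encode = wOf ψ.matrix ψ.quants ψ.quants.length n (List.replicate (Mof n) false) := by
    rw [zW, fanoutFn_apply, fanoutFn_apply, fanoutFn_apply, fanoutFn_apply, fanoutFn_apply, hC, hQ, hV, hU, hN, hM]
    rfl
  have hpre : (zerosOf ∘ preOf ∘ fanoutFn zN (polyFn (30 * X ^ 5) ∘ zN)) ψ.encode = List.replicate (pre n) false := by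
    rw [Function.comp_apply, Function.comp_apply, fanoutFn_apply, hN, Function.comp_apply, hN, polyFn_apply,
      preOf_apply n _ (by simp [ones]), zerosOf_apply, ones, List.length_replicate]
  rw [zWord, Function.comp_apply, fanoutFn_apply, Function.comp_apply, fanoutFn_apply, Function.comp_apply, hW, ptBitsF_apply, Function.comp_apply, hblk,
    zerosOf_apply, Function.comp_apply, fanoutFn_apply, hpre, Function.comp_apply, hml, zerosOf_apply, appF_boolPair, appF_boolPair, appF_boolPair,
    wordOf, preQBF3]
  simp only [ones, List.length_replicate, List.append_assoc]
  rw [natBits_zero', List.replicate_append_replicate, show h n 0 - ptLen n - blk n = pre n + mlen n by rw [h]; omega]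

/-- The reduction on the code of a closed formula. [cite: TrevisanVadhan2007, Thm. 4.3] -/
theorem redFn_encode {ψ : PrenexQBF} (hc : ψ.IsClosed) :
    redFn ψ.encode = wordOf (QBFUniv.sizeOf ψ) (ubv (instOf (QBFUniv.sizeOf ψ) (preQBF3 ψ).quants (cnfP3 ψ.matrix ψ.quants.length)))
      ⟨0, blk_pos _⟩ (h (QBFUniv.sizeOf ψ) 0) := by
  rw [redFn, iteFn_apply (validFn_encode ψ), decide_eq_true hc, if_pos rfl, zWord_encode]

/-- The reduction off the codes of closed formulas. [folklore] -/
theorem redFn_of_invalid {z : List Bool} (hz : validFn z ≠ [true]) : redFn z = [] := by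
  obtain ⟨b, hb⟩ := oneBit_validFn z
  cases b
  · rw [redFn, iteFn_apply hb]; rfl
  · exact absurd hb hz

/-! ### `F` on the word of a described formula -/

open Classical in
/-- **`F` on the query word of a Boolean point at stage `0`, selector `0`, is the truth of the
described formula** (the canonical length `h n 0` parses back to `(n, 0)`). [cite: TrevisanVadhan2007, Lemma 4.1 (ii), Thm. 4.3 (proof)] -/
theorem FB_wordOf_zero (n : ℕ) (b : UVar n → Bool) :
    FB (wordOf n (ubv b) ⟨0, blk_pos n⟩ (h n 0)) = decide (HoldsL b (List.finRange n)) := by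
  have hlen : (wordOf n (ubv b) ⟨0, blk_pos n⟩ (h n 0)).length = h n 0 := length_wordOf n _ _ (by rw [h]; omega)
  rw [FB, hlen, nOf_h, iOf_h (Nat.zero_le _), if_pos (by rw [h]; omega), Fni_zero_ubv]

/-- The empty word is not in the language (its length is not canonical). [folklore] -/
theorem FB_nil : FB [] = false := by
  rw [FB, if_neg]
  rw [List.length_nil]
  have := blk_pos (nOf 0)
  omega

/-! ### The Karp reduction and the hardness -/

open Classical in
/-- **`TQBF ≤ₚ LTV`** (Trevisan–Vadhan 2007, Thm. 4.3 via Lemma 4.1 (ii): every closed prenex QBF is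
an instance of the universal formula, and `F` at stage `0` is `f_{n,0}` on Boolean points).
[cite: TrevisanVadhan2007, Thm. 4.3, Lemma 4.1 (ii)] -/
theorem tqbf_reducible_LTV : TQBF ≤ₚ LTV := by
  have key : ∀ w : List Bool, w ∈ LTV ↔ FB w = true := fun w => Iff.rfl
  refine polyTimeKarpReducible_iff.2 ⟨redFn, redFn_mem_FP, fun z => ?_⟩
  by_cases hv : validFn z = [true]
  · obtain ⟨ψ, rfl, hc⟩ := exists_of_validFn_eq_true hv
    rw [encode_mem_TQBF_iff, redFn_encode hc, key, FB_wordOf_zero, decide_eq_true_iff, ← holdsFrom_zero,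
      ← isTrue_iff_holdsFrom_pre3 hc]
    exact ⟨fun h => h.2, fun h => ⟨hc, h⟩⟩
  · rw [redFn_of_invalid hv, key, FB_nil]
    simp only [Bool.false_eq_true, iff_false]
    rintro ⟨ψ, rfl, hc, -⟩
    rw [validFn_encode, decide_eq_true hc] at hv
    exact hv rfl

/-- **TREVISAN–VADHAN'S LANGUAGE IS `PSPACE`-HARD.** [cite: TrevisanVadhan2007, Thm. 4.3] -/
theorem isHard_PSPACE_LTV : IsHard PSPACE LTV := IsHard.of_reducible_holds isHard_PSPACE_TQBF tqbf_reducible_LTV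

end TVHard

/-! ### Murray–Williams: the headline, discharged -/

/-- **The language of Murray–Williams' Thm. 2.2 exists** (`PSPACE`-hard, paddable, without all-ones
words, downward self-reducible, same-length checkable): the ones-zero padding of Trevisan–Vadhan's
language. [cite: MurrayWilliams2018, Thm. 2.2 (SIAM Thm. 2.7)] [cite: TrevisanVadhan2007, Thm. 4.3, Thm. 5.4] [cite: Santhanam2009, Lemma 12] -/
theorem MurrayWilliams2018_thm_2_2_language :
    ∃ L : Language Bool, IsHard PSPACE L ∧ (∀ x : List Bool, true :: x ∈ L ↔ x ∈ L) ∧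
      (∀ n : ℕ, List.replicate n true ∉ L) ∧ Nonempty (AlmostAE.DSR L) ∧ Nonempty (AlmostAE.SameLengthChecker L) :=
  MurrayWilliams2018_thm_2_2_language_of_isHard_LTV TVHard.isHard_PSPACE_LTV

/-- **MURRAY–WILLIAMS' HEADLINE `NQP ⊄ ACC⁰`, DISCHARGED**: the tree's named fact
`MurrayWilliams2018_NQP_not_subset_ACC0 : ¬ (NQP ⊆ ACC0)` holds — Thm. 3.1 (both halves), the easy
witness Lemma 4.1 (polylogarithmic-seed form), Lemma 1.3, machine `B`, Williams' Fact 3.1 / Thm. 4.1,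
Thm. 5.1 and now the language of Thm. 2.2 (Trevisan–Vadhan + Santhanam) are all theorems of the tree.
[cite: MurrayWilliams2018, §1.1, Thm. 1.3] -/
theorem MurrayWilliams2018_NQP_not_subset_ACC0_holds : MurrayWilliams2018_NQP_not_subset_ACC0 :=
  MurrayWilliams2018_NQP_not_subset_ACC0_of_isHard_LTV TVHard.isHard_PSPACE_LTV

/-- **Lemma 4.1 (a.e. form) from a generator of Umans' type alone** (MW Thm. 2.1 = Umans 2003 Thm. 6 is
the only remaining input). [cite: MurrayWilliams2018, Lemma 4.1, Thm. 2.1] -/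
theorem MurrayWilliams2018_lemma_4_1_ae_of_umansGenerator (G : UmansGenerator) : MurrayWilliams2018_lemma_4_1_ae :=
  MurrayWilliams2018_lemma_4_1_ae_of_isHard_LTV_of_umansGenerator TVHard.isHard_PSPACE_LTV G

end Literature.Computability.Complexity

end
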